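import Mathlib
import HarnessLib

/-!
# Route `PoloidalWindowDoor`, crux `PoloidalWindowRigidity` (stmt-19708) / item `LrcModEntire` (stmt-20428), ideator line `thread_axis`
# (ns-idea-8) — stub S7′-M `stub_morseLevelPackage`, helper I: RAYS THROUGH A HORIZONTALLY CONCAVE `C²` FUNCTION

Seat ns-poloidal-K2-p2 g10 (LEAD-lineage on 19708; file `--supports`).  Pure calculus for the parametrised Morse package of the thick
column's Morse branch (thread_axis v10 S7′-M, plan endorsed by idea-crit-7 10:40:41Z): for `g : ℝ³ → ℝ` of class `C²`,

* `hasDerivAt_ray`, `hasDerivAt_ray_deriv` — derivatives of `t ↦ g(o + t•u)` (`= dg(o+tu)u`) and of `t ↦ dg(o + t•u)u` (`= D²g(o+tu)(u,u)`);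
* `fderiv_fderiv_apply_const` — `D(x ↦ dg(x)e)(y)w = D²g(y)(w)(e)` (the stub's way of writing the horizontal Hessian);
* `exists_concavity_ball` — if `D²g(0)(e,e) < 0` for all horizontal unit `e`, then `D²g(y)(e,e) < 0` for all `y` in a closed ball around `0`
  and all horizontal unit `e` (generalized tube lemma over the compact horizontal unit circle);
* `fderiv2_apply_nonpos_of_max` — at a global maximum `D²g(0)(e,e) ≤ 0` (second-derivative test, contrapositive);
* `ray_crossing` — the 1-D crossing lemma: `φ'' < 0` on `[0,L]`, `φ 0 > c > φ L` ⇒ a UNIQUE root `r ∈ (0,L)` of `φ = c`, with `φ' r < 0`,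
  `φ > c` before and `φ < c` after it;
* `ray_strictAnti_of_deriv_zero` — `φ' 0 = 0`, `φ'' < 0` on `[0,L]` ⇒ `φ` strictly decreasing on `[0,L]`.

WHAT THIS IS NOT: not a claim about Navier–Stokes; one-variable calculus (bears_on LADDER-NS N0 via crux 19708 / item 20428, thread_axis S7′-M). [folklore]
-/

noncomputable section

-- the summit and its single sub-problem share the name (CONVENTIONS §1), as in every Theorems file
set_option linter.dupNamespace false

namespace Summit.NavierStokesRegularity.NavierStokesRegularity.Theorems.PoloidalWindowDoorLrcModEntireMorseLevelRays

open Set Function Filter Topology Metric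

variable {g : EuclideanSpace ℝ (Fin 3) → ℝ}

/-! ### Derivatives along rays -/

/-- `d/dt g(o + t•u) = dg(o + t•u) u`. [folklore] -/
theorem hasDerivAt_ray (hg : Differentiable ℝ g) (o u : EuclideanSpace ℝ (Fin 3)) (t : ℝ) :
    HasDerivAt (fun s : ℝ => g (o + s • u)) (fderiv ℝ g (o + t • u) u) t := by
  have h1 : HasDerivAt (fun s : ℝ => o + s • u) u t := by
    simpa using ((hasDerivAt_id t).smul_const u).const_add o
  have h2 : HasDerivAt (g ∘ fun s : ℝ => o + s • u) (fderiv ℝ g (o + t • u) u) t :=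
    (hg (o + t • u)).hasFDerivAt.comp_hasDerivAt t h1
  exact h2

/-- `D(x ↦ dg(x)e)(y) w = D²g(y)(w)(e)` for `g ∈ C²`. [folklore] -/
theorem fderiv_fderiv_apply_const (hg : ContDiff ℝ 2 g) (y e w : EuclideanSpace ℝ (Fin 3)) :
    fderiv ℝ (fun x => fderiv ℝ g x e) y w = fderiv ℝ (fderiv ℝ g) y w e := by
  have hd : DifferentiableAt ℝ (fderiv ℝ g) y :=
    ((hg.fderiv_right (m := 1) le_rfl).differentiable one_ne_zero) y
  rw [fderiv_clm_apply hd (differentiableAt_const e)]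
  simp

/-- `x ↦ dg(x)e` is `C¹` for `g ∈ C²`. [folklore] -/
theorem contDiff_fderiv_apply_const (hg : ContDiff ℝ 2 g) (e : EuclideanSpace ℝ (Fin 3)) :
    ContDiff ℝ 1 (fun x => fderiv ℝ g x e) :=
  (hg.fderiv_right (m := 1) le_rfl).clm_apply contDiff_const

/-- `d/dt dg(o + t•u)u = D(x ↦ dg(x)u)(o + t•u) u` (`= D²g(o+tu)(u,u)`). [folklore] -/
theorem hasDerivAt_ray_deriv (hg : ContDiff ℝ 2 g) (o u : EuclideanSpace ℝ (Fin 3)) (t : ℝ) :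
    HasDerivAt (fun s : ℝ => fderiv ℝ g (o + s • u) u) (fderiv ℝ (fun x => fderiv ℝ g x u) (o + t • u) u) t := by
  have hd : Differentiable ℝ (fun x => fderiv ℝ g x u) := (contDiff_fderiv_apply_const hg u).differentiable one_ne_zero
  exact hasDerivAt_ray hd o u t

/-- `(y, e) ↦ D²g(y)(e)(e)` is continuous for `g ∈ C²`. [folklore] -/
theorem continuous_fderiv2_apply (hg : ContDiff ℝ 2 g) :
    Continuous fun q : EuclideanSpace ℝ (Fin 3) × EuclideanSpace ℝ (Fin 3) => fderiv ℝ (fderiv ℝ g) q.1 q.2 q.2 := by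
  have hc : Continuous (fderiv ℝ (fderiv ℝ g)) :=
    ((hg.fderiv_right (m := 1) le_rfl).fderiv_right (m := 0) le_rfl).continuous
  exact ((hc.comp continuous_fst).clm_apply continuous_snd).clm_apply continuous_snd

/-! ### The concavity ball -/

/-- The horizontal unit circle `{e | e₂ = 0, ‖e‖ = 1}` is compact. [folklore] -/
theorem isCompact_horizontalCircle :
    IsCompact {e : EuclideanSpace ℝ (Fin 3) | e 2 = 0 ∧ ‖e‖ = 1} := by
  have hclosed : IsClosed {e : EuclideanSpace ℝ (Fin 3) | e 2 = 0} :=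
    isClosed_eq (EuclideanSpace.proj (2 : Fin 3)).continuous continuous_const
  have h : {e : EuclideanSpace ℝ (Fin 3) | e 2 = 0 ∧ ‖e‖ = 1} = {e | e 2 = 0} ∩ sphere 0 1 := by
    ext e; simp
  rw [h]
  exact (isCompact_sphere 0 1).inter_left hclosed

/-- **The concavity ball.**  If `D²g(0)(e,e) < 0` for every horizontal unit vector `e`, then there is `δ > 0` with `D²g(y)(e,e) < 0` for
all `‖y‖ ≤ δ` and all horizontal unit `e` (continuity of `D²g` and compactness of the horizontal unit circle, via the generalized tube
lemma). [folklore] -/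
theorem exists_concavity_ball (hg : ContDiff ℝ 2 g)
    (hneg : ∀ e : EuclideanSpace ℝ (Fin 3), e 2 = 0 → ‖e‖ = 1 → fderiv ℝ (fderiv ℝ g) 0 e e < 0) :
    ∃ δ : ℝ, 0 < δ ∧ ∀ y ∈ closedBall (0 : EuclideanSpace ℝ (Fin 3)) δ, ∀ e : EuclideanSpace ℝ (Fin 3),
      e 2 = 0 → ‖e‖ = 1 → fderiv ℝ (fderiv ℝ g) y e e < 0 := by
  set S : Set (EuclideanSpace ℝ (Fin 3)) := {e | e 2 = 0 ∧ ‖e‖ = 1} with hS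
  set n : Set (EuclideanSpace ℝ (Fin 3) × EuclideanSpace ℝ (Fin 3)) := {q | fderiv ℝ (fderiv ℝ g) q.1 q.2 q.2 < 0} with hn
  have hno : IsOpen n := isOpen_lt (continuous_fderiv2_apply hg) continuous_const
  have hsub : ({0} : Set (EuclideanSpace ℝ (Fin 3))) ×ˢ S ⊆ n := by
    rintro ⟨y, e⟩ ⟨hy, he⟩
    rw [mem_singleton_iff] at hy
    subst hy
    exact hneg e he.1 he.2
  obtain ⟨u, v, hu, -, h0u, hSv, huv⟩ := generalized_tube_lemma isCompact_singleton isCompact_horizontalCircle hno hsub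
  have h0 : (0 : EuclideanSpace ℝ (Fin 3)) ∈ u := h0u (mem_singleton 0)
  obtain ⟨ε, hε, hball⟩ := Metric.isOpen_iff.1 hu 0 h0
  refine ⟨ε / 2, by positivity, fun y hy e he1 he2 => ?_⟩
  have hyu : y ∈ u := hball (mem_ball.2 (lt_of_le_of_lt (mem_closedBall.1 hy) (by linarith)))
  have : (y, e) ∈ n := huv (mk_mem_prod hyu (hSv ⟨he1, he2⟩))
  exact this

/-! ### Second-order condition at a maximum -/

/-- **At a global maximum the Hessian is negative semi-definite**: `g ≤ g 0` everywhere and `g ∈ C²` ⇒ `D²g(0)(e,e) ≤ 0` for every `e`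
(if it were positive, the second-derivative test would make `0` a strict local minimum of `t ↦ g(t•e)`, so `g(t•e)` would be constant
near `0` and the second derivative would vanish). [folklore] -/
theorem fderiv2_apply_nonpos_of_max (hg : ContDiff ℝ 2 g) (hmax : ∀ x, g x ≤ g 0) (e : EuclideanSpace ℝ (Fin 3)) :
    fderiv ℝ (fderiv ℝ g) 0 e e ≤ 0 := by
  set φ : ℝ → ℝ := fun t => g ((0 : EuclideanSpace ℝ (Fin 3)) + t • e) with hφ
  have hgd : Differentiable ℝ g := hg.differentiable two_ne_zero
  have hφd : ∀ t, HasDerivAt φ (fderiv ℝ g (0 + t • e) e) t := fun t => hasDerivAt_ray hgd 0 e t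
  have hderiv : deriv φ = fun t => fderiv ℝ g (0 + t • e) e := funext fun t => (hφd t).deriv
  have hφ'd : ∀ t, HasDerivAt (deriv φ) (fderiv ℝ (fun x => fderiv ℝ g x e) (0 + t • e) e) t := by
    rw [hderiv]; exact fun t => hasDerivAt_ray_deriv hg 0 e t
  have hdd0 : deriv (deriv φ) 0 = fderiv ℝ (fderiv ℝ g) 0 e e := by
    rw [(hφ'd 0).deriv, fderiv_fderiv_apply_const hg]
    simp
  by_contra hpos
  rw [not_le, ← hdd0] at hpos
  -- `0` is a maximum of `φ`, hence a critical point
  have hmaxφ : IsLocalMax φ 0 := Filter.Eventually.of_forall fun t => by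
    simp only [hφ, zero_add, zero_smul]
    exact hmax _
  have hd0 : deriv φ 0 = 0 := hmaxφ.deriv_eq_zero
  have hmin : IsLocalMin φ 0 := isLocalMin_of_deriv_deriv_pos hpos hd0 (hφd 0).continuousAt
  -- so `φ` is constant near `0`, and its second derivative vanishes there
  have hconst : φ =ᶠ[𝓝 0] fun _ => φ 0 := by
    filter_upwards [hmin, hmaxφ] with t h1 h2 using le_antisymm h2 h1
  have hd1 : deriv φ =ᶠ[𝓝 0] fun _ => 0 := by
    filter_upwards [hconst.eventuallyEq_nhds] with t ht
    rw [ht.deriv_eq, deriv_const]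
  have hd2 : deriv (deriv φ) 0 = 0 := by rw [hd1.deriv_eq, deriv_const]
  rw [hd2] at hpos
  exact lt_irrefl 0 hpos

/-- At a global maximum the gradient vanishes. [folklore] -/
theorem fderiv_eq_zero_of_max (hmax : ∀ x, g x ≤ g 0) : fderiv ℝ g 0 = 0 :=
  IsLocalMax.fderiv_eq_zero (Filter.Eventually.of_forall fun x => hmax x)

/-! ### One-variable crossing lemmas -/

section Crossing

variable {φ φ' φ'' : ℝ → ℝ} {L c : ℝ}

/-- `φ'' < 0` on `[0,L]` ⇒ `φ'` strictly decreasing on `[0,L]`. [folklore] -/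
theorem strictAntiOn_deriv_of_neg (hφ' : ∀ t, HasDerivAt φ' (φ'' t) t) (hneg : ∀ t ∈ Icc 0 L, φ'' t < 0) :
    StrictAntiOn φ' (Icc 0 L) := by
  refine strictAntiOn_of_deriv_neg (convex_Icc 0 L) (fun t _ => (hφ' t).continuousAt.continuousWithinAt) fun t ht => ?_
  rw [(hφ' t).deriv]
  exact hneg t (interior_subset ht)

/-- **The crossing lemma.**  If `φ'' < 0` on `[0,L]`, `φ 0 > c` and `φ L < c`, then `φ = c` has a UNIQUE root `r ∈ (0,L)`; there
`φ' r < 0`; `φ > c` on `[0,r)` and `φ < c` on `(r,L]`. [folklore] -/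
theorem ray_crossing (hL : 0 < L) (hφ : ∀ t, HasDerivAt φ (φ' t) t) (hφ' : ∀ t, HasDerivAt φ' (φ'' t) t)
    (hneg : ∀ t ∈ Icc 0 L, φ'' t < 0) (h0 : c < φ 0) (hLc : φ L < c) :
    ∃ r ∈ Ioo 0 L, φ r = c ∧ φ' r < 0 ∧ (∀ t ∈ Icc 0 L, φ t = c → t = r) ∧
      (∀ t ∈ Icc 0 L, t < r → c < φ t) ∧ (∀ t ∈ Icc 0 L, r < t → φ t < c) := by
  have hanti := strictAntiOn_deriv_of_neg hφ' hneg
  have hcont : Continuous φ := continuous_iff_continuousAt.2 fun t => (hφ t).continuousAt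
  -- slopes are negative: between `0` and any root the mean value theorem gives a negative derivative
  have hslope : ∀ r ∈ Ioc 0 L, φ r ≤ c → ∃ ξ ∈ Ioo 0 r, φ' ξ < 0 := by
    intro r hr hrc
    obtain ⟨ξ, hξ, hξe⟩ := exists_hasDerivAt_eq_slope φ φ' hr.1 hcont.continuousOn (fun t _ => hφ t)
    refine ⟨ξ, hξ, ?_⟩
    rw [hξe, sub_zero]
    exact div_neg_of_neg_of_pos (by linarith) hr.1
  -- no two roots
  have huniq : ∀ t₁ ∈ Icc 0 L, ∀ t₂ ∈ Icc 0 L, t₁ < t₂ → φ t₁ = c → φ t₂ = c → False := by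
    intro t₁ ht₁ t₂ ht₂ hlt h1 h2
    have ht₁0 : 0 < t₁ := by
      rcases eq_or_lt_of_le ht₁.1 with h | h
      · rw [← h] at h1; linarith
      · exact h
    obtain ⟨ξ₀, hξ₀, hξ₀n⟩ := hslope t₁ ⟨ht₁0, ht₁.2⟩ h1.le
    obtain ⟨ξ, hξ, hξe⟩ := exists_hasDerivAt_eq_slope φ φ' hlt hcont.continuousOn (fun t _ => hφ t)
    have hξ0 : φ' ξ = 0 := by rw [hξe, h1, h2, sub_self, zero_div]
    have hlt' : ξ₀ < ξ := hξ₀.2.trans hξ.1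
    have hξ₀I : ξ₀ ∈ Icc 0 L := ⟨hξ₀.1.le, (hξ₀.2.le.trans ht₁.2)⟩
    have hξI : ξ ∈ Icc 0 L := ⟨(ht₁.1.trans hξ.1.le), hξ.2.le.trans ht₂.2⟩
    have := hanti hξ₀I hξI hlt'
    linarith
  -- existence by the intermediate value theorem
  obtain ⟨r, hrI, hrc⟩ : ∃ r ∈ Icc 0 L, φ r = c := by
    have := intermediate_value_Icc' hL.le hcont.continuousOn (show c ∈ Icc (φ L) (φ 0) from ⟨hLc.le, h0.le⟩)
    obtain ⟨r, hr, hrc⟩ := this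
    exact ⟨r, hr, hrc⟩
  have hr0 : 0 < r := by
    rcases eq_or_lt_of_le hrI.1 with h | h
    · rw [← h] at hrc; linarith
    · exact h
  have hrL : r < L := by
    rcases eq_or_lt_of_le hrI.2 with h | h
    · rw [h] at hrc; linarith
    · exact h
  have hroot : ∀ t ∈ Icc 0 L, φ t = c → t = r := by
    intro t ht htc
    rcases lt_trichotomy t r with h | h | h
    · exact (huniq t ht r hrI h htc hrc).elim
    · exact h
    · exact (huniq r hrI t ht h hrc htc).elim
  refine ⟨r, ⟨hr0, hrL⟩, hrc, ?_, hroot, ?_, ?_⟩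
  · -- `φ' r < 0`
    obtain ⟨ξ, hξ, hξn⟩ := hslope r ⟨hr0, hrL.le⟩ hrc.le
    have := hanti ⟨hξ.1.le, hξ.2.le.trans hrL.le⟩ hrI hξ.2
    linarith
  · -- before the root
    intro t ht htr
    by_contra hle
    rw [not_lt] at hle
    rcases eq_or_lt_of_le hle with h | h
    · exact absurd (hroot t ht h) (ne_of_lt htr)
    · -- a root in `(0, t)`, hence `< r`: contradiction
      have ht0 : 0 < t := by
        rcases eq_or_lt_of_le ht.1 with h' | h'
        · rw [← h'] at h; linarith
        · exact h'
      obtain ⟨s, hs, hsc⟩ := intermediate_value_Ioo' ht0.le (hcont.continuousOn (s := Icc 0 t))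
        (show c ∈ Ioo (φ t) (φ 0) from ⟨h, h0⟩)
      have hsI : s ∈ Icc 0 L := ⟨hs.1.le, hs.2.le.trans ht.2⟩
      have := hroot s hsI hsc
      linarith [hs.2]
  · -- after the root
    intro t ht hrt
    by_contra hle
    rw [not_lt] at hle
    rcases eq_or_lt_of_le hle with h | h
    · exact absurd (hroot t ht h.symm) (ne_of_gt hrt)
    · obtain ⟨s, hs, hsc⟩ := intermediate_value_Ioo' ht.2 (hcont.continuousOn (s := Icc t L))
        (show c ∈ Ioo (φ L) (φ t) from ⟨hLc, h⟩)
      have hsI : s ∈ Icc 0 L := ⟨ht.1.trans hs.1.le, hs.2.le⟩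
      have := hroot s hsI hsc
      linarith [hs.1]

/-- **A critical ray of a concave function descends**: `φ' 0 = 0` and `φ'' < 0` on `[0,L]` ⇒ `φ` is strictly decreasing on `[0,L]`;
in particular `φ t < φ 0` for `0 < t ≤ L`. [folklore] -/
theorem ray_strictAnti_of_deriv_zero (hφ : ∀ t, HasDerivAt φ (φ' t) t) (hφ' : ∀ t, HasDerivAt φ' (φ'' t) t)
    (hneg : ∀ t ∈ Icc 0 L, φ'' t < 0) (h0 : φ' 0 = 0) : StrictAntiOn φ (Icc 0 L) := by
  have hanti := strictAntiOn_deriv_of_neg hφ' hneg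
  refine strictAntiOn_of_deriv_neg (convex_Icc 0 L) (fun t _ => (hφ t).continuousAt.continuousWithinAt) fun t ht => ?_
  rw [interior_Icc] at ht
  rw [(hφ t).deriv, ← h0]
  exact hanti (left_mem_Icc.2 (ht.1.le.trans ht.2.le)) ⟨ht.1.le, ht.2.le⟩ ht.1

end Crossing

end Summit.NavierStokesRegularity.NavierStokesRegularity.Theorems.PoloidalWindowDoorLrcModEntireMorseLevelRays

end
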